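import Summits.AtomisticToContinuum.HydrodynamicLimit.Theorems.OneFlightGossipEngineClampedCurrentsDockHeartFreeze
import Summits.AtomisticToContinuum.HydrodynamicLimit.Theorems.OneFlightGossipEngineClampedCurrentsDockCollisionalId
import Summits.AtomisticToContinuum.HydrodynamicLimit.Theorems.OneFlightGossipEngineClampedCurrentsDockFlowShiftFreeze
import Summits.AtomisticToContinuum.HydrodynamicLimit.Theorems.OneFlightGossipEngineClampedCurrentsDockFreezeToolkit
import HarnessLib

/-!
# The heart of Yau's entropy ledger — domination of the entropy production of one window (crux `ClampedCurrentsDock`, stmt-14680, line `IdeatorTwoSketch`)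

Helper file (`--supports stmt-AtomisticToContinuum-14680`) for the registered stub `stub_oneWindowLedger`: on the good set, the
entropy production `−(Str + Col)` of the one-window balance along the explicit reference family is dominated by the frozen
kinetic channel, the cubic channel, the four clamped centred collisional rows (collisional identification CC1 on the shifted orbit,
flow shift FS), the static centring total, the activity tails and the two freezing errors (S8 pointwise, FZ, S10 at contact scale).
prover-line-stmt-AtomisticToContinuum-14680-c2-0 (lead c2).
-/

noncomputable section

namespace Summit.AtomisticToContinuum.HydrodynamicLimit.Theorems.ClampedCurrentsDockHeart

open scoped BigOperators ENNReal Classical Interval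
open MeasureTheory Filter Set Topology InformationTheory
open Literature.MathematicalPhysics.KineticTheory Literature.Analysis.FluidPDE Literature.Analysis.FunctionSpaces
open Summit.AtomisticToContinuum.HydrodynamicLimit.Theorems

/-- `Σ_i (3 + 2 f_i) = 3(N+1) + 2 Σ_i f_i` over `Fin (N+1)`. [folklore] -/
theorem sum_three_add_two_mul (N : ℕ) (f : Fin (N + 1) → ℝ) :
    (∑ i : Fin (N + 1), (3 + 2 * f i)) = 3 * ((N : ℝ) + 1) + 2 * ∑ i : Fin (N + 1), f i := by
  rw [Finset.sum_add_distrib, Finset.sum_const, Finset.card_univ, Fintype.card_fin, Finset.mul_sum]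
  simp only [nsmul_eq_mul, Nat.cast_add, Nat.cast_one]
  ring

/-- **DOMINATION OF THE ENTROPY PRODUCTION OF ONE WINDOW ON THE GOOD SET.** See the file header; the right side is the
`hdom` hypothesis of `window_bookkeeping` with the concrete functionals of the heart. [cite: Yau1991, §3] -/
theorem window_domination {σ T η₁ τ t s w V L Cfz : ℝ} {N : ℕ}
    (Φ : HardSphereFlow (Torus.geometry (Fin 3)) (hsDiameter σ N) (N + 1))
    {ρ θ : ℝ → T3 → ℝ} {u : ℝ → T3 → V3} {F Rf : ℝ → ℝ} {G : ℝ → T3 × ℝ → ℝ}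
    (hEul : IsHardSphereEulerSolution σ T ρ u θ) (hσ : 0 < σ) (hσ2 : σ < 1 / 2) (hη₁ : 0 < η₁)
    (hF : AnalyticOnNhd ℝ F (Ioo (-η₁) η₁)) (hZF : ∀ η ∈ Ioo 0 η₁, hsCompressibility η = 1 + η * deriv F η)
    (hRfF : ∀ η ∈ Ioo 0 η₁, 0 < Rf η ∧ DifferentiableAt ℝ (fun x => Real.log (Rf x)) η ∧
      deriv (fun x => Real.log (Rf x)) η = 2 * deriv F η + η * deriv (deriv F) η)
    (hpackF : ∀ t' ∈ Ico 0 T, ∀ x, ρ t' x * σ ^ 3 ∈ Ioo 0 η₁)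
    (ha : Torus.IsSmoothSpaceTimeOn (Ico 0 T) fun t' x => ρ t' x * Rf (σ ^ 3 * ρ t' x))
    (ha0 : ∀ t' ∈ Ico 0 T, ∀ x, 0 < ρ t' x * Rf (σ ^ 3 * ρ t' x))
    (ht : t ∈ Ioo 0 T) (hs0 : 0 ≤ s) (hw : 0 < w) (hsw : s + w ≤ t) (hτ : 0 < τ)
    (hw_def : w = τ * ((N : ℝ) + 1) ^ (-(1 / 3 : ℝ)))
    (hV0 : 0 ≤ V) (hL0 : 0 ≤ L) (hCfz0 : 0 ≤ Cfz)
    (hLipm : ∀ (k : Fin 3) (x y : T3), |u s x k / θ s x - u s y k / θ s y| ≤ L * Torus.euclidDist x y)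
    (hLipe : ∀ x y : T3, |(-(θ s x)⁻¹) - (-(θ s y)⁻¹)| ≤ L * Torus.euclidDist x y)
    (hGs : Continuous (G s))
    (HFZ : ∀ s₁ ∈ Icc 0 t, ∀ s₂ ∈ Icc 0 t, ∀ (x : T3) (v : V3),
      (let fast := fun (s : ℝ) (y : T3 × V3) =>
         (θ s y.1)⁻¹ * ∑ j : Fin 3, ∑ k : Fin 3,
             ((y.2 - u s y.1) j * (y.2 - u s y.1) k - (if j = k then ‖y.2 - u s y.1‖ ^ 2 / 3 else 0)) *
               Torus.partialDeriv k (fun x => u s x j) y.1 +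
           (‖y.2 - u s y.1‖ ^ 2 - 5 * θ s y.1) * (∑ k : Fin 3, (y.2 - u s y.1) k * Torus.partialDeriv k (θ s) y.1) /
             (2 * (θ s y.1) ^ 2)
       let P := fun (s : ℝ) (y : T3 × V3) =>
         (∑ k : Fin 3, Torus.partialDeriv k (fun x => u s x k / θ s x) y.1) *
           (θ s y.1 * (ρ s y.1 * σ ^ 3) * deriv hsCompressibility (ρ s y.1 * σ ^ 3) +
             (1 / 3) * (hsCompressibility (ρ s y.1 * σ ^ 3) - 1) * ‖y.2 - u s y.1‖ ^ 2) +
         ((∑ k : Fin 3, u s y.1 k * Torus.partialDeriv k (θ s) y.1) / (θ s y.1) ^ 2) *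
           (θ s y.1 * (ρ s y.1 * σ ^ 3) * deriv hsCompressibility (ρ s y.1 * σ ^ 3) +
             (1 / 3) * (hsCompressibility (ρ s y.1 * σ ^ 3) - 1) * ‖y.2 - u s y.1‖ ^ 2) +
         (hsCompressibility (ρ s y.1 * σ ^ 3) - 1) *
           (∑ k : Fin 3, (y.2 - u s y.1) k * Torus.partialDeriv k (θ s) y.1) / θ s y.1
       |fast s₁ (x, v) - fast s₂ (x, v)| ≤ Cfz * |s₁ - s₂| * (1 + ‖v‖ ^ 3) ∧
       |P s₁ (x, v) - P s₂ (x, v)| ≤ Cfz * |s₁ - s₂| * (1 + ‖v‖ ^ 2) ∧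
       (∀ (k : Fin 3) (x' : T3),
          |(u s₁ x k / θ s₁ x - u s₁ x' k / θ s₁ x') - (u s₂ x k / θ s₂ x - u s₂ x' k / θ s₂ x')| ≤
            Cfz * |s₁ - s₂| * Torus.euclidDist x x') ∧
       (∀ x' : T3, |((θ s₁ x)⁻¹ - (θ s₁ x')⁻¹) - ((θ s₂ x)⁻¹ - (θ s₂ x')⁻¹)| ≤ Cfz * |s₁ - s₂| * Torus.euclidDist x x') ∧
       (∀ (k : Fin 3) (x' : T3), |u s₁ x k / θ s₁ x - u s₁ x' k / θ s₁ x'| ≤ Cfz * Torus.euclidDist x x') ∧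
       (∀ x' : T3, |(-(θ s₁ x)⁻¹) - (-(θ s₁ x')⁻¹)| ≤ Cfz * Torus.euclidDist x x')))
    {z : Config (N + 1) (Fin 3) T3} (hz : z ∈ Φ.good) :
    -((∫ r' in s..(s + w), ∑ i : Fin (N + 1),
        (Torus.timeDerivWithin (Ico 0 T) (fun t'' x =>
            Real.log (ρ t'' x * Rf (σ ^ 3 * ρ t'' x)) - 3 / 2 * Real.log (2 * Real.pi * θ t'' x) -
              ‖(Φ.flow r' z i).2 - u t'' x‖ ^ 2 / (2 * θ t'' x)) r' (Φ.flow r' z i).1 +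
          ∑ k : Fin 3, (Φ.flow r' z i).2 k * Torus.partialDeriv k (fun x =>
            Real.log (ρ r' x * Rf (σ ^ 3 * ρ r' x)) - 3 / 2 * Real.log (2 * Real.pi * θ r' x) -
              ‖(Φ.flow r' z i).2 - u r' x‖ ^ 2 / (2 * θ r' x)) (Φ.flow r' z i).1)) +
      Φ.collisionSum (Ioc s (s + w)) (fun c =>
        ((∑ k : Fin 3, (u c.time c.fstPos k / θ c.time c.fstPos - u c.time c.sndPos k / θ c.time c.sndPos) *
            (c.postVel.1 k - c.preVel.1 k)) -
          ((θ c.time c.fstPos)⁻¹ - (θ c.time c.sndPos)⁻¹) * ((‖c.postVel.1‖ ^ 2 - ‖c.preVel.1‖ ^ 2) / 2)) / 2) z) ≤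
    -(∫ r' in s..(s + w), ∑ i : Fin (N + 1),
        ((θ s (Φ.flow r' z i).1)⁻¹ * ∑ j : Fin 3, ∑ k : Fin 3,
            (((Φ.flow r' z i).2 - u s (Φ.flow r' z i).1) j * ((Φ.flow r' z i).2 - u s (Φ.flow r' z i).1) k -
              (if j = k then ‖(Φ.flow r' z i).2 - u s (Φ.flow r' z i).1‖ ^ 2 / 3 else 0)) *
              Torus.partialDeriv k (fun x => u s x j) (Φ.flow r' z i).1 +
          (∑ k : Fin 3, Torus.partialDeriv k (θ s) (Φ.flow r' z i).1 / (2 * (θ s (Φ.flow r' z i).1) ^ 2) *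
            ((Φ.flow r' z i).2 - u s (Φ.flow r' z i).1) k) *
            G s ((Φ.flow r' z i).1, ‖(Φ.flow r' z i).2 - u s (Φ.flow r' z i).1‖ ^ 2))) +
    |∫ r' in s..(s + w), ∑ i : Fin (N + 1),
        (∑ k : Fin 3, Torus.partialDeriv k (θ s) (Φ.flow r' z i).1 / (2 * (θ s (Φ.flow r' z i).1) ^ 2) *
            ((Φ.flow r' z i).2 - u s (Φ.flow r' z i).1) k) *
          (‖(Φ.flow r' z i).2 - u s (Φ.flow r' z i).1‖ ^ 2 - 5 * θ s (Φ.flow r' z i).1 -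
            G s ((Φ.flow r' z i).1, ‖(Φ.flow r' z i).2 - u s (Φ.flow r' z i).1‖ ^ 2))| +
    ((∑ k : Fin 3, (((∫ r' in s..(s + w), ∑ i : Fin (N + 1),
        Torus.partialDeriv k (fun x => u s x k / θ s x) (Φ.flow r' z i).1 *
          (θ s (Φ.flow r' z i).1 * (ρ s (Φ.flow r' z i).1 * σ ^ 3) * deriv hsCompressibility (ρ s (Φ.flow r' z i).1 * σ ^ 3) +
            (1 / 3) * (hsCompressibility (ρ s (Φ.flow r' z i).1 * σ ^ 3) - 1) *
              ‖(Φ.flow r' z i).2 - u s (Φ.flow r' z i).1‖ ^ 2)) -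
        (w * ((N : ℝ) + 1) * ∫ x, ρ s x * Torus.partialDeriv k (fun x => u s x k / θ s x) x *
          (θ s x * (ρ s x * σ ^ 3) * deriv hsCompressibility (ρ s x * σ ^ 3)))) -
        (Φ.collisionSum (Ioc 0 w) (fun c =>
          (if σ / τ * Φ.collisionSum (Ioc 0 w) (fun c' => if c'.fst = c.fst then
              ‖c'.postVel.1 - c'.preVel.1‖ + |‖c'.postVel.1‖ ^ 2 - ‖c'.preVel.1‖ ^ 2| / 2 else 0) (Φ.flow s z) ≤ V
            then (1 : ℝ) else 0) *
          (if σ / τ * Φ.collisionSum (Ioc 0 w) (fun c' => if c'.fst = c.snd then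
              ‖c'.postVel.1 - c'.preVel.1‖ + |‖c'.postVel.1‖ ^ 2 - ‖c'.preVel.1‖ ^ 2| / 2 else 0) (Φ.flow s z) ≤ V
            then (1 : ℝ) else 0) *
          ((u s c.fstPos k / θ s c.fstPos - u s c.sndPos k / θ s c.sndPos) * (c.postVel.1 k - c.preVel.1 k)) / 2)
          (Φ.flow s z)))) +
      (((∫ r' in s..(s + w), ∑ i : Fin (N + 1),
        ((∑ l : Fin 3, u s (Φ.flow r' z i).1 l * Torus.partialDeriv l (fun x => -(θ s x)⁻¹) (Φ.flow r' z i).1) *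
            (θ s (Φ.flow r' z i).1 * (ρ s (Φ.flow r' z i).1 * σ ^ 3) * deriv hsCompressibility (ρ s (Φ.flow r' z i).1 * σ ^ 3) +
            (1 / 3) * (hsCompressibility (ρ s (Φ.flow r' z i).1 * σ ^ 3) - 1) *
              ‖(Φ.flow r' z i).2 - u s (Φ.flow r' z i).1‖ ^ 2) +
          θ s (Φ.flow r' z i).1 * (hsCompressibility (ρ s (Φ.flow r' z i).1 * σ ^ 3) - 1) *
            (∑ l : Fin 3, Torus.partialDeriv l (fun x => -(θ s x)⁻¹) (Φ.flow r' z i).1 *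
              ((Φ.flow r' z i).2 - u s (Φ.flow r' z i).1) l))) -
        (w * ((N : ℝ) + 1) * ∫ x, ρ s x * (∑ l : Fin 3, u s x l * Torus.partialDeriv l (fun x => -(θ s x)⁻¹) x) *
          (θ s x * (ρ s x * σ ^ 3) * deriv hsCompressibility (ρ s x * σ ^ 3)))) -
        (Φ.collisionSum (Ioc 0 w) (fun c =>
          (if σ / τ * Φ.collisionSum (Ioc 0 w) (fun c' => if c'.fst = c.fst then
              ‖c'.postVel.1 - c'.preVel.1‖ + |‖c'.postVel.1‖ ^ 2 - ‖c'.preVel.1‖ ^ 2| / 2 else 0) (Φ.flow s z) ≤ V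
            then (1 : ℝ) else 0) *
          (if σ / τ * Φ.collisionSum (Ioc 0 w) (fun c' => if c'.fst = c.snd then
              ‖c'.postVel.1 - c'.preVel.1‖ + |‖c'.postVel.1‖ ^ 2 - ‖c'.preVel.1‖ ^ 2| / 2 else 0) (Φ.flow s z) ≤ V
            then (1 : ℝ) else 0) *
          ((-(θ s c.fstPos)⁻¹ - -(θ s c.sndPos)⁻¹) * ((‖c.postVel.1‖ ^ 2 - ‖c.preVel.1‖ ^ 2) / 2)) / 2) (Φ.flow s z)))) +
    (2 * L * w + 2 * Cfz * w ^ 2) * (∑ i : Fin (N + 1), Set.indicator {y : ℝ | V < y} (fun y => y)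
      (σ / τ * Φ.collisionSum (Ioc s (s + w)) (fun c => if c.fst = i then
        ‖c.postVel.1 - c.preVel.1‖ + |‖c.postVel.1‖ ^ 2 - ‖c.preVel.1‖ ^ 2| / 2 else 0) z)) +
    (2 * Cfz * w) * (∫ r' in s..(s + w), ∑ i : Fin (N + 1), ‖(Φ.flow r' z i).2‖ ^ 3) +
    (w * ((N : ℝ) + 1) * (∫ x, ρ s x * (ρ s x * σ ^ 3) * deriv hsCompressibility (ρ s x * σ ^ 3) * Torus.divergence (u s) x) +
      3 * Cfz * w ^ 2 * ((N : ℝ) + 1) + 2 * Cfz * w ^ 2 * (((N : ℝ) + 1) * V)) := by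
  subst hw_def
  have hsw' : s ≤ s + τ * ((N : ℝ) + 1) ^ (-(1 / 3 : ℝ)) := le_add_of_nonneg_right hw.le
  have hsT : s ∈ Set.Ico 0 T := ⟨hs0, (hsw'.trans hsw).trans_lt ht.2⟩
  have hs_t : s ∈ Set.Icc 0 t := ⟨hs0, hsw'.trans hsw⟩
  have hIcc_t : Set.Icc s (s + (τ * ((N : ℝ) + 1) ^ (-(1 / 3 : ℝ)))) ⊆ Set.Icc 0 t := fun r hr => ⟨hs0.trans hr.1, hr.2.trans hsw⟩
  have hsw_T : s + (τ * ((N : ℝ) + 1) ^ (-(1 / 3 : ℝ))) < T := hsw.trans_lt ht.2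
  obtain ⟨hFS, -⟩ := ClampedCurrentsDockFlowShiftFreeze.stub_flowShiftFreeze
  have hCC1 := ClampedCurrentsDockCollisionalId.stub_collisionalIdentification
  -- slices at the window start
  have hθs : Torus.IsSmooth (θ s) := hEul.smooth_temperature.isSmooth_slice hsT
  have hus : Torus.IsSmooth (u s) := hEul.smooth_velocity.isSmooth_slice hsT
  have hρs : Torus.IsSmooth (ρ s) := hEul.smooth_density.isSmooth_slice hsT
  have hθsc : Continuous (θ s) := hθs.continuous
  have husc : Continuous (u s) := hus.continuous
  have hρsc : Continuous (ρ s) := hρs.continuous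
  have hθs0 : ∀ x, 0 < θ s x := hEul.temperature_pos s hsT
  obtain ⟨hZst, hZ'st⟩ := ClampedCurrentsDockFreezeToolkit.sst_hsCompressibility_comp (S := Set.Ico 0 T) hF hZF
    hEul.smooth_density hpackF
  have hZc : Continuous fun x => hsCompressibility (ρ s x * σ ^ 3) := (hZst.isSmooth_slice hsT).continuous
  have hZ'c : Continuous fun x => deriv hsCompressibility (ρ s x * σ ^ 3) := (hZ'st.isSmooth_slice hsT).continuous
  have hpdθ : ∀ k, Continuous (Torus.partialDeriv k (θ s)) := fun k => (hθs.partialDeriv k).continuous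
  have hpdu : ∀ k j, Continuous (Torus.partialDeriv k (fun x => u s x j)) := fun k j =>
    ((hus.apply j).partialDeriv k).continuous
  have hφms : ∀ k, Torus.IsSmooth (fun x => u s x k / θ s x) := fun k => (hus.apply k).div hθs fun _ => (hθs0 _).ne'
  have hφes : Torus.IsSmooth (fun x => -(θ s x)⁻¹) := (hθs.inv fun _ => (hθs0 _).ne').neg
  have hpdm : ∀ k, Continuous (Torus.partialDeriv k (fun x => u s x k / θ s x)) := fun k =>
    ((hφms k).partialDeriv k).continuous
  have hpde : ∀ l, Continuous (Torus.partialDeriv l (fun x => -(θ s x)⁻¹)) := fun l =>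
    (hφes.partialDeriv l).continuous
  -- abstract coefficient functions (for `fun_prop`)
  set Zf : T3 → ℝ := fun x => hsCompressibility (ρ s x * σ ^ 3) with hZf
  set Z'f : T3 → ℝ := fun x => deriv hsCompressibility (ρ s x * σ ^ 3) with hZ'f
  set Dm : Fin 3 → T3 → ℝ := fun k => Torus.partialDeriv k (fun x => u s x k / θ s x) with hDm
  set Dθ : Fin 3 → T3 → ℝ := fun k => Torus.partialDeriv k (θ s) with hDθ
  set Du : Fin 3 → Fin 3 → T3 → ℝ := fun k j => Torus.partialDeriv k (fun x => u s x j) with hDu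
  have hDmc : ∀ k, Continuous (Dm k) := hpdm
  have hDθc : ∀ k, Continuous (Dθ k) := hpdθ
  have hDuc : ∀ k j, Continuous (Du k j) := hpdu
  -- the frozen kinetic functionals at the window start
  set loF : T3 × V3 → ℝ := fun y =>
    (θ s y.1)⁻¹ * ∑ j : Fin 3, ∑ k : Fin 3,
        ((y.2 - u s y.1) j * (y.2 - u s y.1) k - (if j = k then ‖y.2 - u s y.1‖ ^ 2 / 3 else 0)) *
          Torus.partialDeriv k (fun x => u s x j) y.1 +
      (∑ k : Fin 3, Torus.partialDeriv k (θ s) y.1 / (2 * (θ s y.1) ^ 2) * (y.2 - u s y.1) k) *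
        G s (y.1, ‖y.2 - u s y.1‖ ^ 2) with hloF
  set hiF : T3 × V3 → ℝ := fun y =>
    (∑ k : Fin 3, Torus.partialDeriv k (θ s) y.1 / (2 * (θ s y.1) ^ 2) * (y.2 - u s y.1) k) *
      (‖y.2 - u s y.1‖ ^ 2 - 5 * θ s y.1 - G s (y.1, ‖y.2 - u s y.1‖ ^ 2)) with hhiF
  -- FZ's families (verbatim)
  set fastF : ℝ → T3 × V3 → ℝ := fun (s : ℝ) (y : T3 × V3) =>
    (θ s y.1)⁻¹ * ∑ j : Fin 3, ∑ k : Fin 3,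
        ((y.2 - u s y.1) j * (y.2 - u s y.1) k - (if j = k then ‖y.2 - u s y.1‖ ^ 2 / 3 else 0)) *
          Torus.partialDeriv k (fun x => u s x j) y.1 +
      (‖y.2 - u s y.1‖ ^ 2 - 5 * θ s y.1) * (∑ k : Fin 3, (y.2 - u s y.1) k * Torus.partialDeriv k (θ s) y.1) /
        (2 * (θ s y.1) ^ 2) with hfastF
  set PF : ℝ → T3 × V3 → ℝ := fun (s : ℝ) (y : T3 × V3) =>
    (∑ k : Fin 3, Torus.partialDeriv k (fun x => u s x k / θ s x) y.1) *
        (θ s y.1 * (ρ s y.1 * σ ^ 3) * deriv hsCompressibility (ρ s y.1 * σ ^ 3) +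
          (1 / 3) * (hsCompressibility (ρ s y.1 * σ ^ 3) - 1) * ‖y.2 - u s y.1‖ ^ 2) +
      ((∑ k : Fin 3, u s y.1 k * Torus.partialDeriv k (θ s) y.1) / (θ s y.1) ^ 2) *
        (θ s y.1 * (ρ s y.1 * σ ^ 3) * deriv hsCompressibility (ρ s y.1 * σ ^ 3) +
          (1 / 3) * (hsCompressibility (ρ s y.1 * σ ^ 3) - 1) * ‖y.2 - u s y.1‖ ^ 2) +
      (hsCompressibility (ρ s y.1 * σ ^ 3) - 1) *
        (∑ k : Fin 3, (y.2 - u s y.1) k * Torus.partialDeriv k (θ s) y.1) / θ s y.1 with hPF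
  -- C0's streaming integrand (verbatim) and collision kernel; the kernel frozen at the window start
  set DgF : ℝ → T3 × V3 → ℝ := fun (t' : ℝ) (y : T3 × V3) =>
    Torus.timeDerivWithin (Set.Ico 0 T) (fun t'' x => (fun (t : ℝ) (y : T3 × V3) =>
      Real.log (ρ t y.1 * Rf (σ ^ 3 * ρ t y.1)) - 3 / 2 * Real.log (2 * Real.pi * θ t y.1) - ‖y.2 - u t y.1‖ ^ 2 / (2 * θ t y.1)) t'' (x, y.2)) t' y.1 +
    ∑ k : Fin 3, y.2 k * Torus.partialDeriv k (fun x => (fun (t : ℝ) (y : T3 × V3) =>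
      Real.log (ρ t y.1 * Rf (σ ^ 3 * ρ t y.1)) - 3 / 2 * Real.log (2 * Real.pi * θ t y.1) - ‖y.2 - u t y.1‖ ^ 2 / (2 * θ t y.1)) t' (x, y.2)) y.1
    with hDgF
  set Kt : HardSphereCollisionRecord (Fin 3) T3 (N + 1) → ℝ := fun c =>
    ((∑ k : Fin 3, (u c.time c.fstPos k / θ c.time c.fstPos - u c.time c.sndPos k / θ c.time c.sndPos) *
        (c.postVel.1 k - c.preVel.1 k)) -
      ((θ c.time c.fstPos)⁻¹ - (θ c.time c.sndPos)⁻¹) * ((‖c.postVel.1‖ ^ 2 - ‖c.preVel.1‖ ^ 2) / 2)) / 2 with hKt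
  set Ksf : HardSphereCollisionRecord (Fin 3) T3 (N + 1) → ℝ := fun c =>
    ((∑ k : Fin 3, (u s c.fstPos k / θ s c.fstPos - u s c.sndPos k / θ s c.sndPos) * (c.postVel.1 k - c.preVel.1 k)) -
      ((θ s c.fstPos)⁻¹ - (θ s c.sndPos)⁻¹) * ((‖c.postVel.1‖ ^ 2 - ‖c.preVel.1‖ ^ 2) / 2)) / 2 with hKsf
  have hεN : 0 < hsDiameter σ N := hsDiameter_pos hσ N
  have hεw : hsDiameter σ N * τ / σ = (τ * ((N : ℝ) + 1) ^ (-(1 / 3 : ℝ))) := by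
    simp only [hsDiameter]; push_cast; field_simp
  -- ===== the frozen pathwise bookkeeping (window_pathwise) =====
  have hpath := window_pathwise Φ hEul hσ hσ2 hη₁ hF hZF hRfF hpackF ha ha0 ht hs0 hw hsw hCfz0 hGs HFZ hz
  -- the clamped row functionals at the window start (the shared lets of CC1 / MZ / LC1, beta-reduced)
  set De : Fin 3 → T3 → ℝ := fun l => Torus.partialDeriv l (fun x => -(θ s x)⁻¹) with hDe
  set actf : Fin (N + 1) → Config (N + 1) (Fin 3) T3 → ℝ := fun i z => σ / τ * Φ.collisionSum (Set.Ioc 0 (τ * ((N : ℝ) + 1) ^ (-(1 / 3 : ℝ))))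
    (fun c => if c.fst = i then ‖c.postVel.1 - c.preVel.1‖ + |‖c.postVel.1‖ ^ 2 - ‖c.preVel.1‖ ^ 2| / 2 else 0) z
    with hactf
  set Xk : Fin 3 → Config (N + 1) (Fin 3) T3 → ℝ := fun k z => Φ.collisionSum (Set.Ioc 0 (τ * ((N : ℝ) + 1) ^ (-(1 / 3 : ℝ))))
    (fun c => (if actf c.fst z ≤ V then (1 : ℝ) else 0) * (if actf c.snd z ≤ V then (1 : ℝ) else 0) *
      ((u s c.fstPos k / θ s c.fstPos - u s c.sndPos k / θ s c.sndPos) * (c.postVel.1 k - c.preVel.1 k)) / 2) z with hXk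
  set Xe : Config (N + 1) (Fin 3) T3 → ℝ := fun z => Φ.collisionSum (Set.Ioc 0 (τ * ((N : ℝ) + 1) ^ (-(1 / 3 : ℝ))))
    (fun c => (if actf c.fst z ≤ V then (1 : ℝ) else 0) * (if actf c.snd z ≤ V then (1 : ℝ) else 0) *
      ((-(θ s c.fstPos)⁻¹ - -(θ s c.sndPos)⁻¹) * ((‖c.postVel.1‖ ^ 2 - ‖c.preVel.1‖ ^ 2) / 2)) / 2) z with hXe
  set Fk : Fin 3 → T3 × V3 → ℝ := fun k y =>
    Dm k y.1 * (θ s y.1 * (ρ s y.1 * σ ^ 3) * Z'f y.1 + (1 / 3) * (Zf y.1 - 1) * ‖y.2 - u s y.1‖ ^ 2) with hFk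
  set ck : Fin 3 → ℝ := fun k => (τ * ((N : ℝ) + 1) ^ (-(1 / 3 : ℝ))) * ((N : ℝ) + 1) * ∫ x, ρ s x * Dm k x * (θ s x * (ρ s x * σ ^ 3) * Z'f x) with hck
  set Fe : T3 × V3 → ℝ := fun y =>
    (∑ l : Fin 3, u s y.1 l * De l y.1) * (θ s y.1 * (ρ s y.1 * σ ^ 3) * Z'f y.1 + (1 / 3) * (Zf y.1 - 1) * ‖y.2 - u s y.1‖ ^ 2) +
      θ s y.1 * (Zf y.1 - 1) * (∑ l : Fin 3, De l y.1 * (y.2 - u s y.1) l) with hFe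
  set ce : ℝ := (τ * ((N : ℝ) + 1) ^ (-(1 / 3 : ℝ))) * ((N : ℝ) + 1) * ∫ x, ρ s x * (∑ l : Fin 3, u s x l * De l x) * (θ s x * (ρ s x * σ ^ 3) * Z'f x) with hce
  set Jk : Fin 3 → Config (N + 1) (Fin 3) T3 → ℝ := fun k z =>
    ((∫ r' in s..(s + (τ * ((N : ℝ) + 1) ^ (-(1 / 3 : ℝ)))), ∑ i, Fk k (Φ.flow r' z i)) - ck k) - Xk k (Φ.flow s z) with hJk
  set Je : Config (N + 1) (Fin 3) T3 → ℝ := fun z =>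
    ((∫ r' in s..(s + (τ * ((N : ℝ) + 1) ^ (-(1 / 3 : ℝ)))), ∑ i, Fe (Φ.flow r' z i)) - ce) - Xe (Φ.flow s z) with hJe
  set actT : Fin (N + 1) → Config (N + 1) (Fin 3) T3 → ℝ := fun i z => σ / τ * Φ.collisionSum (Set.Ioc s (s + (τ * ((N : ℝ) + 1) ^ (-(1 / 3 : ℝ)))))
    (fun c => if c.fst = i then ‖c.postVel.1 - c.preVel.1‖ + |‖c.postVel.1‖ ^ 2 - ‖c.preVel.1‖ ^ 2| / 2 else 0) z
    with hactT
  set tail : Config (N + 1) (Fin 3) T3 → ℝ := fun z => ∑ i, Set.indicator {y : ℝ | V < y} (fun y => y) (actT i z) with htail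
  set cub : Config (N + 1) (Fin 3) T3 → ℝ := fun z => ∫ r' in s..(s + (τ * ((N : ℝ) + 1) ^ (-(1 / 3 : ℝ)))), ∑ i, ‖(Φ.flow r' z i).2‖ ^ 3 with hcub
  set hiT : Config (N + 1) (Fin 3) T3 → ℝ := fun z => |∫ r' in s..(s + (τ * ((N : ℝ) + 1) ^ (-(1 / 3 : ℝ)))), ∑ i, hiF (Φ.flow r' z i)| with hhiT
  set kin : Config (N + 1) (Fin 3) T3 → ℝ := fun z => -(∫ r' in s..(s + (τ * ((N : ℝ) + 1) ^ (-(1 / 3 : ℝ)))), ∑ i, loF (Φ.flow r' z i)) with hkin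
  set Cst_s : ℝ := ∫ x, ρ s x * (ρ s x * σ ^ 3) * deriv hsCompressibility (ρ s x * σ ^ 3) * Torus.divergence (u s) x
    with hCst_s
  -- CC1 on the shifted orbit, read back through the flow shift
  have hFSz : ∀ z ∈ Φ.good, (Φ.flow s z ∈ Φ.good) ∧
      (∀ f : Config (N + 1) (Fin 3) T3 → ℝ,
        (∫ r' in s..(s + (τ * ((N : ℝ) + 1) ^ (-(1 / 3 : ℝ)))), f (Φ.flow r' z)) = ∫ r' in (0 : ℝ)..(τ * ((N : ℝ) + 1) ^ (-(1 / 3 : ℝ))), f (Φ.flow r' (Φ.flow s z))) ∧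
      (∀ Fc : HardSphereCollisionRecord (Fin 3) T3 (N + 1) → ℝ,
        Φ.collisionSum (Set.Ioc s (s + (τ * ((N : ℝ) + 1) ^ (-(1 / 3 : ℝ))))) (fun c => Fc { c with time := c.time - s }) z =
          Φ.collisionSum (Set.Ioc 0 (τ * ((N : ℝ) + 1) ^ (-(1 / 3 : ℝ)))) Fc (Φ.flow s z)) :=
    fun z hz => ⟨Φ.mapsTo_good s hz, hFS σ N Φ s (τ * ((N : ℝ) + 1) ^ (-(1 / 3 : ℝ))) hs0 hw.le z hz⟩
  have hT3 : ∀ z ∈ Φ.good,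
      (∫ r' in s..(s + (τ * ((N : ℝ) + 1) ^ (-(1 / 3 : ℝ)))), ∑ i, PF s (Φ.flow r' z i)) - Φ.collisionSum (Set.Ioc s (s + (τ * ((N : ℝ) + 1) ^ (-(1 / 3 : ℝ))))) Ksf z ≤
        (∑ k, Jk k z) + Je z + (τ * ((N : ℝ) + 1) ^ (-(1 / 3 : ℝ))) * ((N : ℝ) + 1) * Cst_s + 2 * L * (τ * ((N : ℝ) + 1) ^ (-(1 / 3 : ℝ))) * tail z := by
    intro z hz
    obtain ⟨hz', hshift, hcshift⟩ := hFSz z hz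
    obtain ⟨Rem, hRem, hId⟩ := hCC1 σ N Φ (θ s) (ρ s) (u s) V τ L hσ hσ2 hτ hθs hus hρsc hZc hZ'c hθs0 hL0
      hLipm hLipe _ hz'
    dsimp only at hId hRem
    -- the left side is CC1's left side at the shifted point
    have e1 : (∫ r' in s..(s + (τ * ((N : ℝ) + 1) ^ (-(1 / 3 : ℝ)))), ∑ i, PF s (Φ.flow r' z i)) =
        ∫ r' in (0 : ℝ)..(τ * ((N : ℝ) + 1) ^ (-(1 / 3 : ℝ))), ∑ i, PF s (Φ.flow r' (Φ.flow s z) i) := hshift (fun y => ∑ i, PF s (y i))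
    have e2 : Φ.collisionSum (Set.Ioc s (s + (τ * ((N : ℝ) + 1) ^ (-(1 / 3 : ℝ))))) Ksf z = Φ.collisionSum (Set.Ioc 0 (τ * ((N : ℝ) + 1) ^ (-(1 / 3 : ℝ)))) Ksf (Φ.flow s z) :=
      hcshift Ksf
    have e3 : ∀ k, (∫ r' in (0 : ℝ)..(τ * ((N : ℝ) + 1) ^ (-(1 / 3 : ℝ))), ∑ i, Fk k (Φ.flow r' (Φ.flow s z) i)) =
        ∫ r' in s..(s + (τ * ((N : ℝ) + 1) ^ (-(1 / 3 : ℝ)))), ∑ i, Fk k (Φ.flow r' z i) := fun k => (hshift (fun y => ∑ i, Fk k (y i))).symm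
    have e4 : (∫ r' in (0 : ℝ)..(τ * ((N : ℝ) + 1) ^ (-(1 / 3 : ℝ))), ∑ i, Fe (Φ.flow r' (Φ.flow s z) i)) =
        ∫ r' in s..(s + (τ * ((N : ℝ) + 1) ^ (-(1 / 3 : ℝ)))), ∑ i, Fe (Φ.flow r' z i) := (hshift (fun y => ∑ i, Fe (y i))).symm
    have e5 : ∀ i, actT i z = actf i (Φ.flow s z) := fun i => by
      simp only [hactT, hactf]
      rw [← hcshift]
    have hRem' : Rem ≤ 2 * L * (τ * ((N : ℝ) + 1) ^ (-(1 / 3 : ℝ))) * tail z := by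
      refine (le_abs_self _).trans (hRem.trans (le_of_eq ?_))
      simp only [htail, e5, hactf]
    have hId' : (∫ r' in s..(s + (τ * ((N : ℝ) + 1) ^ (-(1 / 3 : ℝ)))), ∑ i, PF s (Φ.flow r' z i)) - Φ.collisionSum (Set.Ioc s (s + (τ * ((N : ℝ) + 1) ^ (-(1 / 3 : ℝ))))) Ksf z =
        -((∑ k, (Xk k (Φ.flow s z) - ((∫ r' in s..(s + (τ * ((N : ℝ) + 1) ^ (-(1 / 3 : ℝ)))), ∑ i, Fk k (Φ.flow r' z i)) - ck k))) +
          (Xe (Φ.flow s z) - ((∫ r' in s..(s + (τ * ((N : ℝ) + 1) ^ (-(1 / 3 : ℝ)))), ∑ i, Fe (Φ.flow r' z i)) - ce))) +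
          (τ * ((N : ℝ) + 1) ^ (-(1 / 3 : ℝ))) * ((N : ℝ) + 1) * Cst_s + Rem := by
      rw [e1, e2]
      simp only [← e3, ← e4]
      exact hId
    rw [hId']
    simp only [hJk, hJe, Finset.sum_sub_distrib]
    linarith [hRem']
  -- ===== combination =====
  have h1 := hpath
  have h2 := hT3 z hz
  have e6 : (∫ r' in s..(s + (τ * ((N : ℝ) + 1) ^ (-(1 / 3 : ℝ)))), ∑ i, (3 + 2 * ‖(Φ.flow r' z i).2‖ ^ 3)) = 3 * (τ * ((N : ℝ) + 1) ^ (-(1 / 3 : ℝ))) * ((N : ℝ) + 1) + 2 * cub z := by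
    have hI := ClampedCurrentsDockCollisionalIdPrelim.intervalIntegrable_sum_orbit Φ hz (F := fun y : T3 × V3 => ‖y.2‖ ^ 3)
      (by fun_prop) s (s + (τ * ((N : ℝ) + 1) ^ (-(1 / 3 : ℝ))))
    have ept : ∀ r', (∑ i : Fin (N + 1), (3 + 2 * ‖(Φ.flow r' z i).2‖ ^ 3)) =
        3 * ((N : ℝ) + 1) + 2 * ∑ i : Fin (N + 1), ‖(Φ.flow r' z i).2‖ ^ 3 := fun r' =>
      sum_three_add_two_mul N fun i => ‖(Φ.flow r' z i).2‖ ^ 3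
    simp_rw [ept]
    rw [intervalIntegral.integral_add intervalIntegrable_const (hI.const_mul 2), intervalIntegral.integral_const,
      intervalIntegral.integral_const_mul]
    simp only [hcub, smul_eq_mul]
    ring
  have e7 : 2 * (Cfz * (τ * ((N : ℝ) + 1) ^ (-(1 / 3 : ℝ))) * hsDiameter σ N) * ∑ i, Φ.collisionSum (Set.Ioc s (s + (τ * ((N : ℝ) + 1) ^ (-(1 / 3 : ℝ))))) (fun c => if c.fst = i then
      ‖c.postVel.1 - c.preVel.1‖ + |‖c.postVel.1‖ ^ 2 - ‖c.preVel.1‖ ^ 2| / 2 else 0) z =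
      2 * Cfz * (τ * ((N : ℝ) + 1) ^ (-(1 / 3 : ℝ))) ^ 2 * ∑ i, actT i z := by
    simp only [hactT, ← Finset.mul_sum]
    rw [← hεw]
    field_simp
  have e8 : ∑ i, actT i z ≤ ((N : ℝ) + 1) * V + tail z := by
    have h := Finset.sum_le_sum fun i (_ : i ∈ (Finset.univ : Finset (Fin (N + 1)))) =>
      ClampedCurrentsDockHeart.le_add_indicator_of_nonneg (A := actT i z) hV0
    rw [Finset.sum_add_distrib, Finset.sum_const, Finset.card_univ, Fintype.card_fin, nsmul_eq_mul] at h
    simpa only [htail, Nat.cast_add, Nat.cast_one] using h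
  have e9 : 2 * Cfz * (τ * ((N : ℝ) + 1) ^ (-(1 / 3 : ℝ))) ^ 2 * ∑ i, actT i z ≤ 2 * Cfz * (τ * ((N : ℝ) + 1) ^ (-(1 / 3 : ℝ))) ^ 2 * (((N : ℝ) + 1) * V + tail z) :=
    mul_le_mul_of_nonneg_left e8 (by positivity)
  rw [e6, e7] at h1
  simp only [hJk, hJe, htail, hcub, hCst_s, hXk, hXe, hFk, hFe, hck, hce, hactf, hactT, hDm, hDe, hZf, hZ'f] at h1 h2 ⊢
  linarith [h1, h2, e9]


end Summit.AtomisticToContinuum.HydrodynamicLimit.Theorems.ClampedCurrentsDockHeart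

end
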